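import Summits.QuantumAdvantage.QuantumAdvantage.Theorems.WbwObfuscatedGluedTreesKowGenVocabulary

/-!
# Stub `stub_factorisation` — the landed generator factors through the line datum  (crux `WbwObfuscatedGluedTrees`, stmt-QuantumAdvantage-2340; line `knowledge-of-walk-split`, stage 2)

For master data `D`, a reference presentation `Γ₁`, an obfuscator `O` and a PRF scheme `P` with
`GenAdmissible D O P`, the landed generator `gen D.params O P` (indexed by the seed length `n` and the key
material `K = s.take (4 t n)`) agrees with the crux-shaped generator `(D.lineData Γ₁ P).gen O = genObf …` of
stage 1 (indexed by the key alone, level `ℓ = |K| / 4`) on every sufficiently long seed, and the success event of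
clause (C) for the padded answer `ans D.params O P s` is contained in the event "the EXIT's name
`(D.lineData Γ₁ P).answer s` was output".

Proof route: clause (4) of `GenAdmissible` (`4 t n ≤ n`) gives `|K| = 4 t n`, hence `ℓ = t n`, after which every
component agrees definitionally (the vocabulary's `rfl`-lemmas `MasterData.params_*`, `lineData_gen`,
`lineData_answer`) except the obfuscator's coin segment — `genObf` takes `O.coins κ (C₀ K)` seed bits after the
keys, the generator takes `c n` —, and clause (8) of `GenAdmissible` says these agree for `n ≥ n₀`; that `n₀` is
the witness.  The event containment is the generator's `setOf_ans_prefix_subset` (the answer is `name(EXIT)`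
followed by zeros).  [folklore]
-/

set_option linter.dupNamespace false

namespace Summit.QuantumAdvantage.QuantumAdvantage.Theorems.WbwObfuscatedGluedTrees.KnowledgeOfWalk.Generator

open Literature.Computability.Cryptography Literature.Computability.Complexity Filter Asymptotics
open Literature.Computability.Cryptography.ObfuscatedGluedTrees
open Literature.Computability.QuantumComplexity
open Summit.QuantumAdvantage.QuantumAdvantage.Theorems.WbwObfuscatedGluedTrees.Negative (ClauseC)
open Summit.QuantumAdvantage.QuantumAdvantage.Theorems.WbwObfuscatedGluedTrees.KnowledgeOfWalk
  (WalkModel inst KnowledgeOfWalk WordHard Coherent genObf genClear keyed)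
open Summit.QuantumAdvantage.QuantumAdvantage.Cruxes.WbwObfuscatedGluedTrees.KnowledgeOfWalkSplit (LineData)

/-- Under clause (4) of `GenAdmissible` (`4 t n ≤ n`), the key material `s.take (4 t n)` has length `4 t n`, so the
level read off the key is the master parameter: `|K| / 4 = t n`. [folklore] -/
theorem length_take_keyMaterial_div_four (D : MasterData) (h4 : ∀ n, 4 * D.t n ≤ n) (s : List Bool) :
    (s.take (4 * D.t s.length)).length / 4 = D.t s.length := by
  rw [List.length_take, min_eq_left (h4 _)]
  omega

/-- The keyed answer of the line datum is the generator's `name_K(EXIT)` at seed length `|s|`, under clause (4) of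
`GenAdmissible`. [folklore] -/
theorem lineData_answer_eq_exitName (D : MasterData) (Γ₁ : D.Presentation) (P : PuncturablePRFScheme)
    (h4 : ∀ n, 4 * D.t n ≤ n) (s : List Bool) :
    (D.lineData Γ₁ P).answer s = D.params.exitName P s.length (D.params.keyMaterial s) := by
  rw [MasterData.lineData_answer, MasterData.params_exitName, MasterData.params_keyMaterial]
  simp only [keyed]
  rw [length_take_keyMaterial_div_four D h4 s]

/-- Factorisation of `gen D.params O P` through `(D.lineData Γ₁ P).gen O`, eventually in the seed length, and containment of the padded-answer event in the EXIT-name event. [folklore] -/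
theorem stub_factorisation :
    ∀ (D : MasterData) (Γ₁ : D.Presentation) (O : CircuitObfuscator) (P : PuncturablePRFScheme),
      GenAdmissible D O P →
      ∃ n₀ : ℕ, ∀ s : List Bool, n₀ ≤ s.length →
        gen D.params O P s = (D.lineData Γ₁ P).gen O s ∧
          {y | ans D.params O P s <+: y} ⊆ {y | (D.lineData Γ₁ P).answer s <+: y} := by
  intro D Γ₁ O P hadm
  obtain ⟨_, _, _, h4, _, _, _, n₀, h8⟩ := hadm
  refine ⟨n₀, fun s hs => ⟨?_, ?_⟩⟩
  · -- the two generators agree once the coin demand is the coin schedule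
    have hK : (s.take (4 * D.t s.length)).length = 4 * D.t s.length := by
      rw [List.length_take, min_eq_left (h4 _)]
    obtain ⟨_, hc⟩ := h8 s.length hs (s.take (4 * D.t s.length)) hK
    rw [MasterData.lineData_gen]
    simp only [gen, genObf, Params.instCircuit, Params.coins, MasterData.params_keyMaterial,
      MasterData.params_entranceName, MasterData.params_secParam, MasterData.params_coinLen,
      MasterData.params_circ, MasterData.params_N, MasterData.params_keyPartLen]
    rw [length_take_keyMaterial_div_four D h4 s, hc]
  · -- the padded answer has `name(EXIT)` = the keyed answer as a prefix
    rw [lineData_answer_eq_exitName D Γ₁ P h4 s]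
    exact setOf_ans_prefix_subset D.params O P s

end Summit.QuantumAdvantage.QuantumAdvantage.Theorems.WbwObfuscatedGluedTrees.KnowledgeOfWalk.Generator
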